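import Mathlib.FieldTheory.KummerPolynomial
import Mathlib.FieldTheory.Minpoly.Field
import Mathlib.Algebra.CharP.Lemmas
import Mathlib.Algebra.CharP.Algebra
import HarnessLib

/-!
# Stub `stub_frobeniusTwist` for crux stmt-ResolutionOfSingularities-15917 (`RadicialJung.CleanModels`)

The Frobenius twist: with `y₀ ∈ L ∖ K`, `y₀^p = g₀ ∈ K` (`char K = p` prime), coefficients
`c : Fin p → K` with some `c j ≠ 0` for `j ≠ 0`, `ε ∈ K ∖ {0}` and `δ ∈ {0, 1}`, the element
`y := ε (Σ_j c_j y₀^j) + δ` satisfies `y^p = ε^p (Σ_j c_j^p g₀^j) + δ` and `y ∉ K`.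

Proof. The identity is Frobenius additivity/multiplicativity in characteristic `p` together with
`δ^p = δ` for `δ ≤ 1`. For `y ∉ K`: `g₀` is not a `p`-th power in `K` (else `y₀ ∈ K` by
injectivity of Frobenius on `L`), so `X^p - C g₀` is irreducible (`X_pow_sub_C_irreducible_of_prime`)
and is the minimal polynomial of `y₀`; if `y = algebraMap x` then `y₀` is a root of the nonzero
polynomial `Σ_j C (c j) X^j - C ((x - δ)/ε)` of degree `< p`, contradicting minimality.
-/

set_option linter.dupNamespace false

namespace Summit.ResolutionOfSingularities.ResolutionOfSingularities.Theorems.RadicialJung.CleanModels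

open Polynomial

/-- If `y₀ ∉ K` and `y₀ ^ p = g₀ ∈ K` with `p = char K` prime, then the minimal polynomial of
`y₀` over `K` is `X ^ p - C g₀`. -/
theorem minpoly_eq_X_pow_sub_C_of_not_mem_range {K L : Type*} [Field K] [Field L] [Algebra K L]
    (p : ℕ) (hp : p.Prime) [CharP K p] (y₀ : L) (g₀ : K)
    (hy₀ : y₀ ∉ Set.range (algebraMap K L)) (hg₀ : algebraMap K L g₀ = y₀ ^ p) :
    minpoly K y₀ = X ^ p - C g₀ := by
  haveI := Fact.mk hp
  haveI : CharP L p := charP_of_injective_algebraMap (algebraMap K L).injective p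
  have hirr : Irreducible (X ^ p - C g₀) := by
    refine X_pow_sub_C_irreducible_of_prime hp fun b hb => hy₀ ⟨b, ?_⟩
    have h0 : (y₀ - algebraMap K L b) ^ p = 0 := by
      rw [sub_pow_char, ← map_pow, hb, hg₀, sub_self]
    exact (sub_eq_zero.mp ((pow_eq_zero_iff hp.ne_zero).mp h0)).symm
  symm
  refine minpoly.eq_of_irreducible_of_monic hirr ?_ (monic_X_pow_sub_C g₀ hp.ne_zero)
  rw [map_sub, aeval_X_pow, aeval_C, hg₀, sub_self]

/-- **The Frobenius twist.** With `y₀ ∈ L ∖ K`, `y₀^p = g₀ ∈ K` (`char K = p` prime),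
coefficients `c : Fin p → K` with `c j₀ ≠ 0` for some `j₀ ≠ 0`, `ε ∈ K ∖ {0}` and `δ ∈ {0, 1}`:
`ε^p (Σ_j c_j^p g₀^j) + δ = y^p` for `y = ε Σ_j c_j y₀^j + δ`, and `y ∉ K`. -/
theorem stub_frobeniusTwist {K L : Type*} [Field K] [Field L] [Algebra K L] (p : ℕ)
    (hp : p.Prime) [CharP K p] (y₀ : L) (g₀ : K) (hy₀ : y₀ ∉ Set.range (algebraMap K L))
    (hg₀ : algebraMap K L g₀ = y₀ ^ p) (c : Fin p → K) (j₀ : Fin p) (hj₀ : (j₀ : ℕ) ≠ 0)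
    (hc : c j₀ ≠ 0) (ε : K) (hε : ε ≠ 0) (δ : ℕ) (hδ : δ ≤ 1) :
    ∃ y : L, y ∉ Set.range (algebraMap K L) ∧
      algebraMap K L (ε ^ p * (∑ j : Fin p, c j ^ p * g₀ ^ (j : ℕ)) + δ) = y ^ p := by
  haveI := Fact.mk hp
  haveI : CharP L p := charP_of_injective_algebraMap (algebraMap K L).injective p
  -- the `K`-combination of powers of `y₀`
  set s : L := ∑ j : Fin p, algebraMap K L (c j) * y₀ ^ (j : ℕ) with hs
  refine ⟨algebraMap K L ε * s + δ, ?_, ?_⟩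
  · rintro ⟨x, hx⟩
    -- `s` would be in `K`
    have hsx : s = algebraMap K L ((x - δ) / ε) := by
      rw [map_div₀, eq_div_iff ((_root_.map_ne_zero _).mpr hε), map_sub, map_natCast, hx]
      ring
    -- the polynomial of degree `< p` vanishing at `y₀`
    set q : K[X] := ∑ j : Fin p, C (c j) * X ^ (j : ℕ) - C ((x - δ) / ε) with hq
    have hq0 : aeval y₀ q = 0 := by
      have : aeval y₀ (∑ j : Fin p, C (c j) * X ^ (j : ℕ)) = s := by
        rw [map_sum]
        refine Finset.sum_congr rfl fun j _ => ?_
        rw [map_mul, aeval_C, aeval_X_pow]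
      rw [hq, map_sub, this, aeval_C, hsx, sub_self]
    have hqdeg : q.degree < p := by
      refine (degree_sub_le _ _).trans_lt (max_lt (degree_sum_fin_lt c) ?_)
      exact degree_C_le.trans_lt (by exact_mod_cast hp.pos)
    have hqne : q ≠ 0 := by
      intro h
      have hcoeff : q.coeff j₀ = c j₀ := by
        rw [hq, coeff_sub, finsetSum_coeff, coeff_C, if_neg hj₀, sub_zero,
          Finset.sum_eq_single j₀]
        · rw [coeff_C_mul_X_pow, if_pos rfl]
        · intro j _ hj
          rw [coeff_C_mul_X_pow, if_neg (fun h' => hj (Fin.ext h'.symm))]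
        · intro hj; exact absurd (Finset.mem_univ j₀) hj
      exact hc (by rw [← hcoeff, h, coeff_zero])
    have hmin := minpoly.degree_le_of_ne_zero K y₀ hqne hq0
    rw [minpoly_eq_X_pow_sub_C_of_not_mem_range p hp y₀ g₀ hy₀ hg₀,
      degree_X_pow_sub_C hp.pos] at hmin
    exact absurd (hmin.trans_lt hqdeg) (lt_irrefl _)
  · -- the identity `(ε s + δ)^p = ε^p (Σ c_j^p g₀^j) + δ`
    have hδp : ((δ : L)) ^ p = δ := by
      interval_cases δ <;> simp [hp.ne_zero]
    have hsp : s ^ p = algebraMap K L (∑ j : Fin p, c j ^ p * g₀ ^ (j : ℕ)) := by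
      rw [hs, sum_pow_char, map_sum]
      refine Finset.sum_congr rfl fun j _ => ?_
      rw [mul_pow, ← map_pow, ← pow_mul, mul_comm (j : ℕ) p, pow_mul, ← hg₀, ← map_pow,
        ← map_mul]
    rw [add_pow_char, mul_pow, ← map_pow, hsp, hδp, map_add, map_natCast, map_mul]

end Summit.ResolutionOfSingularities.ResolutionOfSingularities.Theorems.RadicialJung.CleanModels
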